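/-
Copyright (c) 2026 the pub-hodgecm-mathlib formalisation cell (harness21).  Prover seat hodgecm-mathlib-F0P2-p06 (g10), 2026-09-01.  Road «S3-tree» (architect A-p16 (g30) A-88 (8)),
brick T3′ «depth-zero κ-transfer», population (P-2) TYPE (2), row (R0²): organ FILE γ₃ «THE TYPE-(2) CAYLEY SHIFT AT A CM PLACE — UNITS AND BINDERS» — the Möbius denominators of
a deep type-(2) `γ_H` are units of `E_v`, and the ★ value theorems' binders (`hN′ hn′ hirr′ hreg′`) hold for the shifted `γ_H′` at the exponents `(n − 2, N − 1)`.
-/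
import Literature.NumberTheory.Rogawski1990.TypeTwoCayleyShiftCM        -- ★ FILE γ₂ (this seat): carriers, `ι∘φ`, matching, κ, the `w`-avatars; brings ★ γ₁, α, β
import Literature.NumberTheory.Rogawski1990.FinExplicitTransferFactorConjRight   -- ★ `isUnit_localRing_of_ne_zero_of_subsingleton`
import HarnessLib

/-!
# The type-(2) Cayley shift at a CM place: the denominators are units, and the shifted pair carries the ★ value theorems' binders at `(n − 2, N − 1)`

Topic `NumberTheory/Rogawski1990`; namespace `Literature.NumberTheory.Rogawski1990`.  THEOREMS ONLY (no definition, no instance, no notation, no named fact, no `sorry`); kernel lane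
`--supports stmt-HodgeConjecture-24833`.  Cell `pub/hodgecm-mathlib`, crux H413; road «S3-tree», brick T3′ «depth-zero κ-transfer», row (R0²) of the ★ type-(2) socket p846003 (census
`F0/P2/F0P2-p06/g10/CENSUS-T3prime-P2-assembly.F0P2p06g10.md` §3 (d)).  HONEST LABEL: HC_CM is proved only modulo the cell's 2 remaining named inputs (hLiu418, h413) until rung 0
closes; this file is an ASSEMBLY over ★ material and asserts nothing printed.

THE MATHEMATICS.  For a type-(2) `γ_H = (g, u)` at a non-split unramified `w ∣ v` which is DEEP in the sense of HEAD v4's `V` — `g_w ≡ 1`, `u_w ≡ 1 (mod c_w)` entrywise, `|c_w| = exp(−1)`,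
`σ(c) = c`, `|2|_w = 1` — with `|disc χ_g|_w = exp(−(2N+1))`, `N ≥ 1`, `|χ_g(u)|_w = exp(−n)`, `n ≥ 2`, `χ_{g_w}` without root: (§1) separability over `E_v = ∏_{w′∣v} L_{w′}` is read at
`w` (`E_v ≃+* L_w` at a non-split `v`); (§2) the Möbius denominators `det((c−1)g + (c+1))`, `det((c+1)g + (c−1))`, `(c∓1)u + (c±1)`, `det((c−1)ι(γ_H) + (c+1))` are UNITS of `E_v` (★ γ₁:
their `w`-components have valuation `exp(−2)`, `exp(−1)`, `exp(−3)`); (§3) for any `γ_H′` with `g′ = φ_c(g)`, `u′ = φ_c(u)` as matrices: `|disc χ_{g′}|_w = exp(−(2(N−1)+1))`,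
`|χ_{g′}(u′)|_w = exp(−(n−2))`, `χ_{g′_w}` has no root, and `γ_H′` is `G`-regular (★ γ₁ dictionary ∘ `φ` commutes with `(·)_w`).

## References
* [Rogawski1990] J. D. Rogawski, *Automorphic Representations of Unitary Groups in Three Variables* (1990), §4.9 Prop. 4.9.1 (b) p. 55; §4.3 p. 42.
* [Kottwitz1986] R. E. Kottwitz, *Base change for unit elements of Hecke algebras*, Compositio Math. 60 (1986), §3.
* [Flicker1998UnitaryFL] Y. Z. Flicker, *Elementary proof of the fundamental lemma for a unitary group*, Canad. J. Math. 50 (1998), §6.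
-/

set_option autoImplicit false

noncomputable section

open NumberField IsDedekindDomain Matrix Polynomial
open scoped MatrixGroups WithZero

namespace Literature.NumberTheory.Rogawski1990

open Literature.NumberTheory.Automorphic Literature.NumberTheory.Automorphic.UnitaryGroup Literature.NumberTheory.Automorphic.MoebiusShift
open Literature.NumberTheory.GaloisRepresentations Literature.NumberTheory.NumberFields

variable (L : Type) [Field L] [NumberField L] [IsCMField L] (v : HeightOneSpectrum (𝓞 ↥(maximalRealSubfield L)))
  (w : PlacesOver L v) (hw : IsCMField.complexConj L • w.1 = w.1)

/-! ## §1 Separability over `E_v` is read at the place `w` (non-split `v`) -/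

omit [IsCMField L] in
/-- **At a non-split `v`, a polynomial over `E_v = ∏_{w′∣v} L_{w′}` is separable iff its `w`-component is** (`E_v ≃+* L_w`, Mathlib `RingEquiv.piUnique`).
[cite: Rogawski1990, §4.3 p. 42] -/
theorem separable_of_map_evalRingHom (hv : Subsingleton (PlacesOver L v)) (p : (LocalRing L v)[X])
    (h : (p.map (Pi.evalRingHom (fun w' : PlacesOver L v => w'.1.adicCompletion L) w)).Separable) : p.Separable := by
  letI : Unique (PlacesOver L v) := uniqueOfSubsingleton w
  let e : LocalRing L v ≃+* w.1.adicCompletion L := RingEquiv.piUnique fun w' : PlacesOver L v => w'.1.adicCompletion L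
  have he : (e : LocalRing L v →+* w.1.adicCompletion L) = Pi.evalRingHom (fun w' : PlacesOver L v => w'.1.adicCompletion L) w := RingHom.ext fun _ => rfl
  have hp : p = (p.map (e : LocalRing L v →+* w.1.adicCompletion L)).map (e.symm : w.1.adicCompletion L →+* LocalRing L v) := by
    rw [Polynomial.map_map]
    change p = p.map (e.symm.toRingHom.comp e.toRingHom)
    rw [RingEquiv.symm_toRingHom_comp_toRingHom, Polynomial.map_id]
  rw [hp]
  refine Polynomial.Separable.map ?_
  rw [he]
  exact h

omit [IsCMField L] [NumberField L] in
/-- `(x·M + y·1).map f = f(x)·M.map f + f(y)·1` for a ring homomorphism `f`. [cite: Kottwitz1986, §3] -/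
theorem map_smul_add_smul_one {R S : Type*} [CommRing R] [CommRing S] {m : Type*} [DecidableEq m] (f : R →+* S) (M : Matrix m m R) (x y : R) :
    (x • M + y • (1 : Matrix m m R)).map f = f x • M.map f + f y • (1 : Matrix m m S) := by
  ext i j; simp [Matrix.map_apply, Matrix.one_apply, apply_ite f]

omit [IsCMField L] [NumberField L] in
/-- `x·reindex e e M + y·1 = reindex e e (x·M + y·1)`. [cite: Kottwitz1986, §3] -/
theorem smul_reindex_add_smul_one {R : Type*} [CommRing R] {m m' : Type*} [DecidableEq m] [DecidableEq m'] (e : m ≃ m') (M : Matrix m m R) (x y : R) :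
    x • Matrix.reindex e e M + y • (1 : Matrix m' m' R) = Matrix.reindex e e (x • M + y • 1) := by
  ext i j; simp [Matrix.reindex_apply, Matrix.one_apply]

omit [IsCMField L] [NumberField L] in
/-- `x·(A ⊕ D) + y·1 = (x·A + y·1) ⊕ (x·D + y·1)`. [cite: Kottwitz1986, §3] -/
theorem smul_fromBlocks_add_smul_one {R : Type*} [CommRing R] {m m' : Type*} [DecidableEq m] [DecidableEq m'] (A : Matrix m m R) (D : Matrix m' m' R) (x y : R) :
    x • Matrix.fromBlocks A 0 0 D + y • (1 : Matrix (m ⊕ m') (m ⊕ m') R) = Matrix.fromBlocks (x • A + y • 1) 0 0 (x • D + y • 1) := by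
  rw [← Matrix.fromBlocks_one, Matrix.fromBlocks_smul, Matrix.fromBlocks_smul, Matrix.fromBlocks_add]
  simp

/-! ## §2 The Möbius denominators of a deep type-(2) `γ_H` are units of `E_v` -/

include hw in
set_option maxHeartbeats 400000 in
-- the carriers' types are large
/-- **THE DENOMINATORS ARE UNITS** (and the `w`-facts they come from): for a deep type-(2) `γ_H = (g, u)` at a non-split unramified `w` (hypotheses as in the module docstring),
`det((c−1)g + (c+1))`, `det((c+1)g + (c−1))`, `(c−1)u + (c+1)`, `(c+1)u + (c−1)` and `det((c−1)ι(γ_H) + (c+1))` are units of `E_v`, with `w`-valuations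
`exp(−2), exp(−2), exp(−1), exp(−1)` for the first four (★ γ₁). [cite: Kottwitz1986, §3] [cite: Rogawski1990, §4.9 Prop. 4.9.1 (b) p. 55] -/
theorem isUnit_shift_denominators_of_typeTwo
    (γH : (cmDatum L 2 (Matrix.of fun i j : Fin 2 => if i.val + j.val + 1 = 2 then (1 : L) else 0)).Local v ×
      (cmDatum L 1 (Matrix.of fun i j : Fin 1 => if i.val + j.val + 1 = 1 then (1 : L) else 0)).Local v)
    {c : LocalRing L v} (hσc : conjLocal L (IsCMField.complexConj L) v c = c) (hc : Valued.v (c w) = WithZero.exp (-1 : ℤ))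
    (h2 : Valued.v (2 : w.1.adicCompletion L) = 1)
    (hg1 : ∀ i j, Valued.v ((((γH.1.val : GL (Fin 2) (LocalRing L v)).val.map (Pi.evalRingHom (fun w' : PlacesOver L v => w'.1.adicCompletion L) w)) - 1) i j) ≤ Valued.v (c w))
    (hu1 : Valued.v (finGammaTwo L v γH w - 1) ≤ Valued.v (c w))
    {N : ℕ} (hN1 : 1 ≤ N)
    (hN : Valued.v (((γH.1.val : GL (Fin 2) (LocalRing L v)).val.map
        (Pi.evalRingHom (fun w' : PlacesOver L v => w'.1.adicCompletion L) w)).trace ^ 2 -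
      4 * ((γH.1.val : GL (Fin 2) (LocalRing L v)).val.map
        (Pi.evalRingHom (fun w' : PlacesOver L v => w'.1.adicCompletion L) w)).det) = WithZero.exp (-((2 * N + 1 : ℕ) : ℤ))) :
    Valued.v ((((c - 1) • ((γH.1.val : GL (Fin 2) (LocalRing L v)).val : Matrix (Fin 2) (Fin 2) (LocalRing L v)) + (c + 1) • (1 : Matrix (Fin 2) (Fin 2) (LocalRing L v))).det) w) =
        WithZero.exp (-2 : ℤ) ∧
      Valued.v ((((c + 1) • ((γH.1.val : GL (Fin 2) (LocalRing L v)).val : Matrix (Fin 2) (Fin 2) (LocalRing L v)) + (c - 1) • (1 : Matrix (Fin 2) (Fin 2) (LocalRing L v))).det) w) =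
        WithZero.exp (-2 : ℤ) ∧
      Valued.v (((c - 1) * finGammaTwo L v γH + (c + 1)) w) = WithZero.exp (-1 : ℤ) ∧
      Valued.v (((c + 1) * finGammaTwo L v γH + (c - 1)) w) = WithZero.exp (-1 : ℤ) ∧
      IsUnit ((((c - 1) • ((γH.1.val : GL (Fin 2) (LocalRing L v)).val : Matrix (Fin 2) (Fin 2) (LocalRing L v)) + (c + 1) • (1 : Matrix (Fin 2) (Fin 2) (LocalRing L v))).det)) ∧
      IsUnit ((((c + 1) • ((γH.1.val : GL (Fin 2) (LocalRing L v)).val : Matrix (Fin 2) (Fin 2) (LocalRing L v)) + (c - 1) • (1 : Matrix (Fin 2) (Fin 2) (LocalRing L v))).det)) ∧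
      IsUnit ((c - 1) * finGammaTwo L v γH + (c + 1)) ∧ IsUnit ((c + 1) * finGammaTwo L v γH + (c - 1)) ∧
      IsUnit ((((c - 1) • ((γH.2.val : GL (Fin 1) (LocalRing L v)).val : Matrix (Fin 1) (Fin 1) (LocalRing L v)) + (c + 1) • (1 : Matrix (Fin 1) (Fin 1) (LocalRing L v))).det)) ∧
      IsUnit ((((c + 1) • ((γH.2.val : GL (Fin 1) (LocalRing L v)).val : Matrix (Fin 1) (Fin 1) (LocalRing L v)) + (c - 1) • (1 : Matrix (Fin 1) (Fin 1) (LocalRing L v))).det)) ∧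
      IsUnit (((c - 1) • (((endoEmbLocal L v γH).val : GL (Fin 3) (LocalRing L v)).val : Matrix (Fin 3) (Fin 3) (LocalRing L v)) + (c + 1) • (1 : Matrix (Fin 3) (Fin 3) (LocalRing L v))).det) := by
  have hv : Subsingleton (PlacesOver L v) := PlacesOver.subsingleton_of_smul_eq (IsCMField.complexConj L) (IsCMField.complexConj_ne_one L) w hw
  set evw : LocalRing L v →+* w.1.adicCompletion L := Pi.evalRingHom (fun w' : PlacesOver L v => w'.1.adicCompletion L) w with hevw
  set σw := galAdicCompletionMap (L := L) (IsCMField.complexConj L) hw with hσw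
  set gw : Matrix (Fin 2) (Fin 2) (w.1.adicCompletion L) := ((γH.1.val : GL (Fin 2) (LocalRing L v)).val.map evw) with hgw
  set uw : w.1.adicCompletion L := finGammaTwo L v γH w with huw
  set cw : w.1.adicCompletion L := c w with hcw
  obtain ⟨hc0, hc1, hcm, hcp, hcm1, hcp1⟩ := shift_parameter_facts hc
  have hσ : ∀ x, Valued.v (σw x) = Valued.v x := fun x => valued_galAdicCompletionMap (L := L) (IsCMField.complexConj L) hw x
  have hσcw : σw cw = cw := by
    have h := congrFun hσc w
    rw [conjLocal_apply_eq_of_smul_eq (IsCMField.complexConj L) (IsCMField.complexConj_ne_one L) v w hw] at h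
    exact h
  -- the `U(Φ₂)`-coordinate: `g_w = 1 + c_w X`
  set X : Matrix (Fin 2) (Fin 2) (w.1.adicCompletion L) := cw⁻¹ • (gw - 1) with hX
  have hgX : gw = 1 + cw • X := eq_one_add_smul_inv_smul_sub_one hc0 gw
  have hXi : ∀ i j, Valued.v (X i j) ≤ 1 := forall_valued_inv_smul_sub_one_le_one hc0 hg1
  have hunit : (((1 : Matrix (Fin 2) (Fin 2) (w.1.adicCompletion L)) + cw • X).map σw)ᵀ * !![(0 : w.1.adicCompletion L), 1; 1, 0] * ((1 : Matrix (Fin 2) (Fin 2) _) + cw • X) =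
      !![(0 : w.1.adicCompletion L), 1; 1, 0] := by
    have h := transpose_map_fst_evalRingHom_mul L v w hw γH
    rw [placeForm_antidiagTwo_eq] at h
    rw [← hgX]
    exact h
  have hN' : Valued.v (((1 : Matrix (Fin 2) (Fin 2) (w.1.adicCompletion L)) + cw • X).trace ^ 2 - 4 * ((1 : Matrix (Fin 2) (Fin 2) _) + cw • X).det) =
      WithZero.exp (-((2 * N + 1 : ℕ) : ℤ)) := by rw [← hgX]; exact hN
  obtain ⟨hskew, hdisc⟩ := skew_and_square_of_unitary_two σw hσ hc hσcw hXi hunit hN1 hN'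
  obtain ⟨hm, hp⟩ := valued_det_two_smul_one_add_shift_smul_eq_one σw hσ h2 hc hXi hskew hdisc
  obtain ⟨hDm, hDp⟩ := valued_det_shift_denominators hc hm hp
  rw [← hgX] at hDm hDp
  -- the `U(Φ₁)`-coordinate: `u_w = 1 + c_w y`
  set y : w.1.adicCompletion L := cw⁻¹ * (uw - 1) with hy
  have huy : uw = 1 + cw * y := by rw [hy, ← mul_assoc, mul_inv_cancel₀ hc0, one_mul, add_sub_cancel]
  have hyi : Valued.v y ≤ 1 := valued_inv_mul_sub_one_le_one hc0 hu1
  have hnorm : σw (1 + cw * y) * (1 + cw * y) = 1 := by rw [← huy]; exact map_finGammaTwo_mul_finGammaTwo L v w hw γH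
  have hyskew := valued_map_add_lt_one_of_unitary_one σw hσ hc0 hc1 hσcw hyi hnorm
  obtain ⟨hym, hyp⟩ := valued_two_add_shift_mul_eq_one σw hσ h2 hc hyi hyskew
  obtain ⟨hum, hup⟩ := valued_shift_denominators_one hc hym hyp
  rw [← huy] at hum hup
  -- reading the `E_v`-elements at `w`
  have hdet2 : ∀ a b : LocalRing L v, ((a • ((γH.1.val : GL (Fin 2) (LocalRing L v)).val : Matrix (Fin 2) (Fin 2) (LocalRing L v)) + b • (1 : Matrix (Fin 2) (Fin 2) (LocalRing L v))).det) w =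
      (a w • gw + b w • (1 : Matrix (Fin 2) (Fin 2) (w.1.adicCompletion L))).det := fun a b => by
    have e1 : ((a • ((γH.1.val : GL (Fin 2) (LocalRing L v)).val : Matrix (Fin 2) (Fin 2) (LocalRing L v)) + b • (1 : Matrix (Fin 2) (Fin 2) (LocalRing L v))).det) w =
        evw ((a • ((γH.1.val : GL (Fin 2) (LocalRing L v)).val : Matrix (Fin 2) (Fin 2) (LocalRing L v)) + b • (1 : Matrix (Fin 2) (Fin 2) (LocalRing L v))).det) := rfl
    rw [e1, RingHom.map_det, RingHom.mapMatrix_apply, map_smul_add_smul_one]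
    rfl
  have hdet1 : ∀ a b : LocalRing L v, ((a • ((γH.2.val : GL (Fin 1) (LocalRing L v)).val : Matrix (Fin 1) (Fin 1) (LocalRing L v)) + b • (1 : Matrix (Fin 1) (Fin 1) (LocalRing L v))).det) w =
      a w * uw + b w := fun a b => by
    have e1 : ((a • ((γH.2.val : GL (Fin 1) (LocalRing L v)).val : Matrix (Fin 1) (Fin 1) (LocalRing L v)) + b • (1 : Matrix (Fin 1) (Fin 1) (LocalRing L v))).det) w =
        evw ((a • ((γH.2.val : GL (Fin 1) (LocalRing L v)).val : Matrix (Fin 1) (Fin 1) (LocalRing L v)) + b • (1 : Matrix (Fin 1) (Fin 1) (LocalRing L v))).det) := rfl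
    rw [e1, Matrix.det_fin_one]
    simp [evw, uw, finGammaTwo]
  have hsc : ∀ a b : LocalRing L v, ((a * finGammaTwo L v γH + b) w) = a w * uw + b w := fun a b => rfl
  have hw2m : Valued.v ((((c - 1) • ((γH.1.val : GL (Fin 2) (LocalRing L v)).val : Matrix (Fin 2) (Fin 2) (LocalRing L v)) + (c + 1) • (1 : Matrix (Fin 2) (Fin 2) (LocalRing L v))).det) w) =
      WithZero.exp (-2 : ℤ) := by rw [hdet2]; exact hDm
  have hw2p : Valued.v ((((c + 1) • ((γH.1.val : GL (Fin 2) (LocalRing L v)).val : Matrix (Fin 2) (Fin 2) (LocalRing L v)) + (c - 1) • (1 : Matrix (Fin 2) (Fin 2) (LocalRing L v))).det) w) =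
      WithZero.exp (-2 : ℤ) := by rw [hdet2]; exact hDp
  have hw1m : Valued.v (((c - 1) * finGammaTwo L v γH + (c + 1)) w) = WithZero.exp (-1 : ℤ) := by rw [hsc]; exact hum
  have hw1p : Valued.v (((c + 1) * finGammaTwo L v γH + (c - 1)) w) = WithZero.exp (-1 : ℤ) := by rw [hsc]; exact hup
  have hne : ∀ {x : LocalRing L v} {z : ℤ}, Valued.v (x w) = WithZero.exp z → IsUnit x := fun {x z} hx =>
    isUnit_localRing_of_ne_zero_of_subsingleton L v hv fun h0 => by rw [h0, Pi.zero_apply, map_zero] at hx; exact WithZero.zero_ne_coe hx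
  have hU2m := hne hw2m
  have hU2p := hne hw2p
  have hU1m := hne hw1m
  have hU1p := hne hw1p
  have hU1m' : IsUnit ((((c - 1) • ((γH.2.val : GL (Fin 1) (LocalRing L v)).val : Matrix (Fin 1) (Fin 1) (LocalRing L v)) + (c + 1) • (1 : Matrix (Fin 1) (Fin 1) (LocalRing L v))).det)) :=
    hne (z := -1) (by rw [hdet1]; exact hum)
  have hU1p' : IsUnit ((((c + 1) • ((γH.2.val : GL (Fin 1) (LocalRing L v)).val : Matrix (Fin 1) (Fin 1) (LocalRing L v)) + (c - 1) • (1 : Matrix (Fin 1) (Fin 1) (LocalRing L v))).det)) :=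
    hne (z := -1) (by rw [hdet1]; exact hup)
  refine ⟨hw2m, hw2p, hw1m, hw1p, hU2m, hU2p, hU1m, hU1p, hU1m', hU1p', ?_⟩
  -- the `3 × 3` denominator of `ι(γ_H)`: block diagonal
  have e3 : (c - 1) • (((endoEmbLocal L v γH).val : GL (Fin 3) (LocalRing L v)).val : Matrix (Fin 3) (Fin 3) (LocalRing L v)) + (c + 1) • (1 : Matrix (Fin 3) (Fin 3) (LocalRing L v)) =
      Matrix.reindex endoPerm endoPerm (Matrix.fromBlocks
        ((c - 1) • ((γH.1.val : GL (Fin 2) (LocalRing L v)).val : Matrix (Fin 2) (Fin 2) (LocalRing L v)) + (c + 1) • (1 : Matrix (Fin 2) (Fin 2) (LocalRing L v))) 0 0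
        ((c - 1) • ((γH.2.val : GL (Fin 1) (LocalRing L v)).val : Matrix (Fin 1) (Fin 1) (LocalRing L v)) + (c + 1) • (1 : Matrix (Fin 1) (Fin 1) (LocalRing L v)))) := by
    rw [coe_endoEmbLocal, coe_endoGL, smul_reindex_add_smul_one, smul_fromBlocks_add_smul_one]
  rw [e3, Matrix.det_reindex_self, Matrix.det_fromBlocks_zero₁₂]
  exact hU2m.mul hU1m'


/-! ## §3 The ★ value theorems' binders for the shifted `γ_H′` at `(n − 2, N − 1)` -/

include hw in
set_option maxHeartbeats 800000 in
-- the carriers' types are large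
/-- **THE SHIFTED BINDERS**: for a deep type-(2) `γ_H` (as in `isUnit_shift_denominators_of_typeTwo`, plus `|χ_g(u)|_w = exp(−n)`, `n ≥ 2`, `χ_{g_w}` rootless) and any `γ_H′` on the
carriers with `g′ = φ_c(g)`, `u′ = φ_c(u)` as matrices: `|disc χ_{g′}|_w = exp(−(2(N−1)+1))`, `|χ_{g′}(u′)|_w = exp(−(n−2))`, `χ_{g′_w}` has no root in `L_w`, and `γ_H′` is `G`-regular
(★ γ₁ dictionary; `φ` commutes with `(·)_w`, ★ γ₂ `map_moebius`). [cite: Flicker1998UnitaryFL, §6] [cite: Rogawski1990, §4.9 Prop. 4.9.1 (b) p. 55; §4.3 p. 42] -/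
theorem shifted_binders_of_typeTwo
    (γH γH' : (cmDatum L 2 (Matrix.of fun i j : Fin 2 => if i.val + j.val + 1 = 2 then (1 : L) else 0)).Local v ×
      (cmDatum L 1 (Matrix.of fun i j : Fin 1 => if i.val + j.val + 1 = 1 then (1 : L) else 0)).Local v)
    {c : LocalRing L v} (hσc : conjLocal L (IsCMField.complexConj L) v c = c) (hc : Valued.v (c w) = WithZero.exp (-1 : ℤ))
    (h2 : Valued.v (2 : w.1.adicCompletion L) = 1)
    (h1 : ((γH'.1.val : GL (Fin 2) (LocalRing L v)).val : Matrix (Fin 2) (Fin 2) (LocalRing L v)) =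
      ((c + 1) • ((γH.1.val : GL (Fin 2) (LocalRing L v)).val : Matrix (Fin 2) (Fin 2) (LocalRing L v)) + (c - 1) • 1) *
        ((c - 1) • ((γH.1.val : GL (Fin 2) (LocalRing L v)).val : Matrix (Fin 2) (Fin 2) (LocalRing L v)) + (c + 1) • 1)⁻¹)
    (hu' : finGammaTwo L v γH' = ((c + 1) * finGammaTwo L v γH + (c - 1)) * Ring.inverse ((c - 1) * finGammaTwo L v γH + (c + 1)))
    (hg1 : ∀ i j, Valued.v ((((γH.1.val : GL (Fin 2) (LocalRing L v)).val.map (Pi.evalRingHom (fun w' : PlacesOver L v => w'.1.adicCompletion L) w)) - 1) i j) ≤ Valued.v (c w))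
    (hu1 : Valued.v (finGammaTwo L v γH w - 1) ≤ Valued.v (c w))
    (hirr : ¬ ∃ x : w.1.adicCompletion L, (((γH.1.val : GL (Fin 2) (LocalRing L v)).val.map
        (Pi.evalRingHom (fun w' : PlacesOver L v => w'.1.adicCompletion L) w)).charpoly).IsRoot x)
    {n N : ℕ} (hn2 : 2 ≤ n) (hN1 : 1 ≤ N)
    (hn : Valued.v (((finCharpolyTwo L v γH).eval (finGammaTwo L v γH)) w) = WithZero.exp (-(n : ℤ)))
    (hN : Valued.v (((γH.1.val : GL (Fin 2) (LocalRing L v)).val.map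
        (Pi.evalRingHom (fun w' : PlacesOver L v => w'.1.adicCompletion L) w)).trace ^ 2 -
      4 * ((γH.1.val : GL (Fin 2) (LocalRing L v)).val.map
        (Pi.evalRingHom (fun w' : PlacesOver L v => w'.1.adicCompletion L) w)).det) = WithZero.exp (-((2 * N + 1 : ℕ) : ℤ))) :
    Valued.v (((γH'.1.val : GL (Fin 2) (LocalRing L v)).val.map
        (Pi.evalRingHom (fun w' : PlacesOver L v => w'.1.adicCompletion L) w)).trace ^ 2 -
      4 * ((γH'.1.val : GL (Fin 2) (LocalRing L v)).val.map
        (Pi.evalRingHom (fun w' : PlacesOver L v => w'.1.adicCompletion L) w)).det) = WithZero.exp (-((2 * (N - 1) + 1 : ℕ) : ℤ)) ∧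
    Valued.v (((finCharpolyTwo L v γH').eval (finGammaTwo L v γH')) w) = WithZero.exp (-((n - 2 : ℕ) : ℤ)) ∧
    (¬ ∃ x : w.1.adicCompletion L, (((γH'.1.val : GL (Fin 2) (LocalRing L v)).val.map
        (Pi.evalRingHom (fun w' : PlacesOver L v => w'.1.adicCompletion L) w)).charpoly).IsRoot x) ∧
    IsLocalGRegular L v γH' := by
  have hv : Subsingleton (PlacesOver L v) := PlacesOver.subsingleton_of_smul_eq (IsCMField.complexConj L) (IsCMField.complexConj_ne_one L) w hw
  obtain ⟨hw2m, -, hw1m, hw1p, hU2m, -, hU1m, -, -, -, -⟩ := isUnit_shift_denominators_of_typeTwo L v w hw γH hσc hc h2 hg1 hu1 hN1 hN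
  set evw : LocalRing L v →+* w.1.adicCompletion L := Pi.evalRingHom (fun w' : PlacesOver L v => w'.1.adicCompletion L) w with hevw
  set gw : Matrix (Fin 2) (Fin 2) (w.1.adicCompletion L) := ((γH.1.val : GL (Fin 2) (LocalRing L v)).val.map evw) with hgw
  set uw : w.1.adicCompletion L := finGammaTwo L v γH w with huw
  set cw : w.1.adicCompletion L := c w with hcw
  obtain ⟨hc0, -, hcm, -, -, -⟩ := shift_parameter_facts hc
  haveI : NeZero (2 : w.1.adicCompletion L) := ⟨fun h => by rw [h, map_zero] at h2; exact zero_ne_one h2⟩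
  -- `g′_w = φ_{c_w}(g_w)` and `u′_w = φ_{c_w}(u_w)`
  have hg'w : ((γH'.1.val : GL (Fin 2) (LocalRing L v)).val.map evw) =
      ((cw + 1) • gw + (cw - 1) • (1 : Matrix (Fin 2) (Fin 2) (w.1.adicCompletion L))) * ((cw - 1) • gw + (cw + 1) • (1 : Matrix (Fin 2) (Fin 2) (w.1.adicCompletion L)))⁻¹ := by
    rw [h1, map_moebius evw _ _ _ hU2m, map_add, map_sub, map_one]
    rfl
  have hD2w : Valued.v (((cw - 1) • gw + (cw + 1) • (1 : Matrix (Fin 2) (Fin 2) (w.1.adicCompletion L))).det) = WithZero.exp (-2 : ℤ) := by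
    have e1 : (((c - 1) • ((γH.1.val : GL (Fin 2) (LocalRing L v)).val : Matrix (Fin 2) (Fin 2) (LocalRing L v)) + (c + 1) • (1 : Matrix (Fin 2) (Fin 2) (LocalRing L v))).det) w =
        evw (((c - 1) • ((γH.1.val : GL (Fin 2) (LocalRing L v)).val : Matrix (Fin 2) (Fin 2) (LocalRing L v)) + (c + 1) • (1 : Matrix (Fin 2) (Fin 2) (LocalRing L v))).det) := rfl
    have e : (((c - 1) • ((γH.1.val : GL (Fin 2) (LocalRing L v)).val : Matrix (Fin 2) (Fin 2) (LocalRing L v)) + (c + 1) • (1 : Matrix (Fin 2) (Fin 2) (LocalRing L v))).det) w =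
        (((cw - 1) • gw + (cw + 1) • (1 : Matrix (Fin 2) (Fin 2) (w.1.adicCompletion L))).det) := by
      rw [e1, RingHom.map_det, RingHom.mapMatrix_apply, map_smul_add_smul_one, map_sub, map_add, map_one]
      rfl
    rw [← e]; exact hw2m
  have huw' : finGammaTwo L v γH' w = ((cw + 1) * uw + (cw - 1)) / ((cw - 1) * uw + (cw + 1)) := by
    have hmul : finGammaTwo L v γH' * ((c - 1) * finGammaTwo L v γH + (c + 1)) = (c + 1) * finGammaTwo L v γH + (c - 1) := by
      rw [hu', mul_assoc, Ring.inverse_mul_cancel _ hU1m, mul_one]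
    have hmw := congrFun hmul w
    simp only [Pi.mul_apply, Pi.add_apply, Pi.sub_apply, Pi.one_apply] at hmw
    have hne : (cw - 1) * uw + (cw + 1) ≠ 0 := fun h => by
      have e : ((c - 1) * finGammaTwo L v γH + (c + 1)) w = (cw - 1) * uw + (cw + 1) := rfl
      rw [e, h, map_zero] at hw1m; exact WithZero.zero_ne_coe hw1m
    rw [eq_div_iff hne]
    exact hmw
  -- (1) the discriminant
  have hN' := valued_disc_moebius h2 hc gw hD2w hN1 hN
  rw [← hg'w] at hN'
  -- (2) the value `χ_{g′}(u′)`
  have hev : ∀ (γ : (cmDatum L 2 (Matrix.of fun i j : Fin 2 => if i.val + j.val + 1 = 2 then (1 : L) else 0)).Local v ×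
      (cmDatum L 1 (Matrix.of fun i j : Fin 1 => if i.val + j.val + 1 = 1 then (1 : L) else 0)).Local v),
      ((finCharpolyTwo L v γ).eval (finGammaTwo L v γ)) w = (((γ.1.val : GL (Fin 2) (LocalRing L v)).val.map evw).charpoly).eval (finGammaTwo L v γ w) := fun γ => by
    have e : ((finCharpolyTwo L v γ).eval (finGammaTwo L v γ)) w = evw ((finCharpolyTwo L v γ).eval (finGammaTwo L v γ)) := rfl
    rw [e, ← Polynomial.eval₂_at_apply, ← Polynomial.eval_map, finCharpolyTwo, ← Matrix.charpoly_map]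
    rfl
  have hnw : Valued.v (gw.charpoly.eval uw) = WithZero.exp (-(n : ℤ)) := by rw [hgw, huw, ← hev]; exact hn
  have hw1m' : Valued.v ((cw - 1) * uw + (cw + 1)) = WithZero.exp (-1 : ℤ) := hw1m
  have hn' := valued_eval_charpoly_moebius h2 hc gw uw hD2w hw1m' hn2 hnw
  rw [← hg'w, ← huw'] at hn'
  rw [← hev] at hn'
  -- (3) no root
  have hD0 : ((cw - 1) • gw + (cw + 1) • (1 : Matrix (Fin 2) (Fin 2) (w.1.adicCompletion L))).det ≠ 0 := fun h => by
    rw [h, map_zero] at hD2w; exact WithZero.zero_ne_coe hD2w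
  have h4c : (cw + 1) ^ 2 - (cw - 1) ^ 2 ≠ 0 := by
    rw [show (cw + 1) ^ 2 - (cw - 1) ^ 2 = 2 * 2 * cw by ring]
    exact mul_ne_zero (mul_ne_zero (NeZero.ne 2) (NeZero.ne 2)) hc0
  have hirr' := not_exists_isRoot_charpoly_moebius gw (cw + 1) (cw - 1) hD0 h4c hirr
  rw [← hg'w] at hirr'
  -- (4) `G`-regularity: separability at `w`, lifted to `E_v`
  have hdisc' : ((γH'.1.val : GL (Fin 2) (LocalRing L v)).val.map evw).trace ^ 2 - 4 * ((γH'.1.val : GL (Fin 2) (LocalRing L v)).val.map evw).det ≠ 0 := fun h => by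
    rw [h, map_zero] at hN'; exact WithZero.zero_ne_coe hN'
  have hval' : (((γH'.1.val : GL (Fin 2) (LocalRing L v)).val.map evw).charpoly).eval (finGammaTwo L v γH' w) ≠ 0 := fun h => by
    rw [hev, h, map_zero] at hn'; exact WithZero.zero_ne_coe hn'
  have hsepw := separable_charpoly_mul_X_sub_C _ _ hdisc' hval'
  have hreg' : IsLocalGRegular L v γH' := by
    have hgoal : (((γH'.1.val : GL (Fin 2) (LocalRing L v)).val : Matrix (Fin 2) (Fin 2) (LocalRing L v)).charpoly *
        ((γH'.2.val : GL (Fin 1) (LocalRing L v)).val : Matrix (Fin 1) (Fin 1) (LocalRing L v)).charpoly).Separable := by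
      refine separable_of_map_evalRingHom L v w hv _ ?_
      rw [Polynomial.map_mul, ← Matrix.charpoly_map, ← Matrix.charpoly_map]
      have hUc : (((γH'.2.val : GL (Fin 1) (LocalRing L v)).val : Matrix (Fin 1) (Fin 1) (LocalRing L v)).map evw).charpoly = X - C (finGammaTwo L v γH' w) := by
        rw [Matrix.charpoly, Matrix.det_fin_one, Matrix.charmatrix_apply_eq, Matrix.map_apply]
        rfl
      rw [hUc]
      exact hsepw
    simp only [IsLocalGRegular, IsGRegular, IsRegularElt, coe_endoEmb, coe_endoGL, Matrix.charpoly_reindex, Matrix.charpoly_fromBlocks_zero₁₂]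
    exact hgoal
  exact ⟨hN', hn', hirr', hreg'⟩

end Literature.NumberTheory.Rogawski1990

end
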